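import Summits.FinalStateConjecture.FinalStateConjecture.Theorems.PhotonSphereChannelsBlindnessChannel

/-!
# Route PhotonSphereChannels · UniformPhotonSphereChannels (K1) — the frozen VELOCITY packet:
# the ansatz `g(x) sin(ωt)/ω`, time reversal, and the near-side energy at one time

Support file (everything proved) for item stmt-FinalStateConjecture-10045 (a refutation of K1 is
being assembled from it).  For a global `C²` solution `ψ` of `ψ_tt − ψ_xx + Vψ = 0` (`V ∈ C¹`,
`V ≥ 0`) with ODD data `(0, g)`, `g ∈ C²` supported in `[α, β]`, vanishing outside the domain of
influence of `[α, β]`, we compare `ψ` with the frozen-oscillation ansatz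
`ψₐ(t, x) = g(x) sin(ωt)/ω` (same Cauchy data; residual `((V − ω²)g − g'') sin(ωt)/ω`):

* `odd_ansatz_facts` — joint `C²` regularity, line derivatives and the residual of `ψₐ`;
* `integrable_energyDensity` — the energy density of such a `ψ` is integrable at every time;
* `near_energy_le_at` — if `|(V − ω²)g − g''| ≤ ωN` then at every time `t ∈ [0, T]` the energy of
  `ψ` on the half-line `(−∞, α)` (where `ψₐ ≡ 0`) is at most `(e − 1) T² (β − α) N²`
  (energy inequality `Blindness.energy_le_of_forcing` for the error field `ψ − ψₐ`);
* `time_reverse` — `(t, x) ↦ ψ(−t, x)` is again such a solution, with data `(0, −g)` and the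
  time-reflected energy density, so the same bound holds at negative times.

No semiclassical input: the packet is compared with a field that does not move at all, over a
time `T` that will be taken of the order of the packet width.  No definitions are introduced.
-/

noncomputable section

open Set Filter MeasureTheory Topology Function

namespace Summit.FinalStateConjecture.FinalStateConjecture.Theorems.FrozenPacket

open Summit.FinalStateConjecture.FinalStateConjecture.Theorems.Blindness

/-! ### The ansatz `ψₐ(t, x) = g(x) sin(ωt)/ω` -/

/-- **Facts on the odd ansatz.** For `g ∈ C²` and a frequency `ω ≠ 0`, the field
`ψₐ(t, x) = g(x) · (sin(ωt)/ω)` is jointly `C²`, vanishes at `t = 0` with `∂_t ψₐ(0, ·) = g`, and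
its residual is `ψₐ,tt − ψₐ,xx + Vψₐ = ((V − ω²) g − g'') · (sin(ωt)/ω)`. -/
theorem odd_ansatz_facts {g : ℝ → ℝ} (hg : ContDiff ℝ 2 g) {ω : ℝ} (hω : ω ≠ 0) (V : ℝ → ℝ) :
    ContDiff ℝ 2 (uncurry fun t x => g x * (Real.sin (ω * t) / ω)) ∧
    (∀ t x, HasDerivAt (fun τ => g x * (Real.sin (ω * τ) / ω)) (g x * Real.cos (ω * t)) t) ∧
    (∀ x, (fun t y => g y * (Real.sin (ω * t) / ω)) 0 x = 0) ∧
    (∀ x, deriv (fun τ => g x * (Real.sin (ω * τ) / ω)) 0 = g x) ∧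
    (∀ t x, iteratedDeriv 2 (fun τ => g x * (Real.sin (ω * τ) / ω)) t
        - iteratedDeriv 2 (fun y => g y * (Real.sin (ω * t) / ω)) x
        + V x * (g x * (Real.sin (ω * t) / ω))
      = ((V x - ω ^ 2) * g x - iteratedDeriv 2 g x) * (Real.sin (ω * t) / ω)) := by
  have hsin : ∀ t, HasDerivAt (fun τ => Real.sin (ω * τ) / ω) (Real.cos (ω * t)) t := by
    intro t
    have h := ((Real.hasDerivAt_sin (ω * t)).comp t ((hasDerivAt_id t).const_mul ω)).div_const ω
    refine (h.congr_of_eventuallyEq (Eventually.of_forall fun _ => rfl)).congr_deriv ?_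
    simp only [mul_one]
    field_simp
  have hcos : ∀ t, HasDerivAt (fun τ => Real.cos (ω * τ)) (-(ω * Real.sin (ω * t))) t := by
    intro t
    have h := (Real.hasDerivAt_cos (ω * t)).comp t ((hasDerivAt_id t).const_mul ω)
    exact (h.congr_of_eventuallyEq (Eventually.of_forall fun _ => rfl)).congr_deriv
      (by simp; ring)
  have hg1 : ∀ x, HasDerivAt g (deriv g x) x := fun x =>
    ((hg.differentiable (by norm_num)) x).hasDerivAt
  have hg' : ContDiff ℝ 1 (deriv g) := by
    have h2 : ContDiff ℝ (1 + 1) g := by simpa [one_add_one_eq_two] using hg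
    exact (contDiff_succ_iff_deriv.1 h2).2.2
  have hg2 : ∀ x, HasDerivAt (deriv g) (iteratedDeriv 2 g x) x := fun x => by
    rw [iteratedDeriv_succ, iteratedDeriv_one]
    exact ((hg'.differentiable one_ne_zero) x).hasDerivAt
  -- time lines
  have ht1 : ∀ t x, HasDerivAt (fun τ => g x * (Real.sin (ω * τ) / ω)) (g x * Real.cos (ω * t)) t :=
    fun t x => (hsin t).const_mul (g x)
  have ht2 : ∀ t x, HasDerivAt (fun τ => g x * Real.cos (ω * τ))
      (-(ω ^ 2 * (g x * (Real.sin (ω * t) / ω)))) t := fun t x => by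
    refine ((hcos t).const_mul (g x)).congr_deriv ?_
    field_simp
  -- space lines
  have hx1 : ∀ t x, HasDerivAt (fun y => g y * (Real.sin (ω * t) / ω))
      (deriv g x * (Real.sin (ω * t) / ω)) x := fun t x => (hg1 x).mul_const _
  have hx2 : ∀ t x, HasDerivAt (fun y => deriv g y * (Real.sin (ω * t) / ω))
      (iteratedDeriv 2 g x * (Real.sin (ω * t) / ω)) x := fun t x => (hg2 x).mul_const _
  refine ⟨?_, ht1, fun x => by simp, fun x => ?_, fun t x => ?_⟩
  · exact (hg.comp contDiff_snd).mul
      ((Real.contDiff_sin.comp (contDiff_const.mul contDiff_fst)).div_const ω)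
  · rw [(ht1 0 x).deriv]; simp
  · rw [iteratedDeriv_two_eq_of_hasDerivAt (fun τ => ht1 τ x) (ht2 t x),
      iteratedDeriv_two_eq_of_hasDerivAt (fun y => hx1 t y) (hx2 t x)]
    ring

/-! ### Energy densities of compactly supported `C²` fields -/

section Energy

/-- The energy density, at a fixed time, of a `C²` field vanishing outside the domain of
influence of `[α, β]` is integrable (`V` continuous). -/
theorem integrable_energyDensity {V : ℝ → ℝ} {ψ : ℝ → ℝ → ℝ} {α β : ℝ} (hV : Continuous V)
    (hψ : ContDiff ℝ 2 (uncurry ψ))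
    (hsupp : ∀ t x, (x < α - |t| ∨ β + |t| < x) → ψ t x = 0) (s : ℝ) :
    Integrable fun x => deriv (fun τ => ψ τ x) s ^ 2 + deriv (ψ s) x ^ 2 + V x * ψ s x ^ 2 := by
  have he_eq : (fun x => deriv (fun τ => ψ τ x) s ^ 2 + deriv (ψ s) x ^ 2 + V x * ψ s x ^ 2)
      = fun x => fderiv ℝ (uncurry ψ) (s, x) (1, 0) ^ 2 + fderiv ℝ (uncurry ψ) (s, x) (0, 1) ^ 2
        + V x * ψ s x ^ 2 := funext fun x => energyDensity_eq hψ s x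
  rw [he_eq]
  have h1 := (continuous_fderiv_apply hψ (1, 0)).comp (Continuous.prodMk_right s)
  have h2 := (continuous_fderiv_apply hψ (0, 1)).comp (Continuous.prodMk_right s)
  have h3 := hψ.continuous.comp (Continuous.prodMk_right s)
  exact integrable_of_fields (s := s) hψ hsupp
    (((h1.pow 2).add (h2.pow 2)).add (hV.mul (h3.pow 2)))
    (fun x h1 h2 h3 _ _ => by simp [h1, h2, h3])

/-- The energy density vanishes outside the domain of influence. -/
theorem energyDensity_eq_zero_of_exterior {V : ℝ → ℝ} {ψ : ℝ → ℝ → ℝ} {α β : ℝ}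
    (hψ : ContDiff ℝ 2 (uncurry ψ))
    (hsupp : ∀ t x, (x < α - |t| ∨ β + |t| < x) → ψ t x = 0) {s x : ℝ}
    (hx : x < α - |s| ∨ β + |s| < x) :
    deriv (fun τ => ψ τ x) s ^ 2 + deriv (ψ s) x ^ 2 + V x * ψ s x ^ 2 = 0 := by
  rw [energyDensity_eq hψ s x]
  obtain ⟨h1, h2, -⟩ := fields_eq_zero_of_exterior hψ hsupp hx (1, 0) (1, 0)
  obtain ⟨-, h4, -⟩ := fields_eq_zero_of_exterior hψ hsupp hx (0, 1) (0, 1)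
  simp [h1, h2, h4]

/-- **The near-side energy at one time.** Let `ψ ∈ C²` solve `ψ_tt − ψ_xx + Vψ = 0` (`V ∈ C¹`,
`V ≥ 0`) with data `(0, g)`, `g ∈ C²` vanishing off `[α, β]`, `ψ` vanishing outside the domain of
influence of `[α, β]`, and let `ω > 0`, `N` with `|(V − ω²) g − g''| ≤ ω N` everywhere.  Then for
`t ∈ [0, T]` the energy of `ψ` on `(−∞, α)` is at most `(e − 1) T² (β − α) N²` — the energy
inequality for the error field `ψ − g sin(ωt)/ω`, which has zero data, forcing of size `≤ N`
supported in `[α, β]`, and which coincides with `ψ` to the left of `α`. -/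
theorem near_energy_le_at {V : ℝ → ℝ} {ψ : ℝ → ℝ → ℝ} {α β : ℝ} (hV1 : ContDiff ℝ 1 V)
    (hVnn : ∀ x, 0 ≤ V x)
    (hψ : ContDiff ℝ 2 (uncurry ψ))
    (hsol : ∀ t x, iteratedDeriv 2 (fun τ => ψ τ x) t - iteratedDeriv 2 (ψ t) x + V x * ψ t x = 0)
    (hsupp : ∀ t x, (x < α - |t| ∨ β + |t| < x) → ψ t x = 0)
    (hψ0 : ∀ x, ψ 0 x = 0) {g : ℝ → ℝ} (hψ1 : ∀ x, deriv (fun τ => ψ τ x) 0 = g x)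
    (hg : ContDiff ℝ 2 g) (hg0 : ∀ x, (x < α ∨ β < x) → g x = 0)
    (hαβ : α ≤ β) {ω T N : ℝ} (hω : 0 < ω) (hT : 0 < T)
    (hres : ∀ x, |(V x - ω ^ 2) * g x - iteratedDeriv 2 g x| ≤ ω * N) :
    ∀ t ∈ Icc 0 T, ∫ x in Iio α,
      (deriv (fun τ => ψ τ x) t ^ 2 + deriv (ψ t) x ^ 2 + V x * ψ t x ^ 2)
        ≤ (Real.exp 1 - 1) * T ^ 2 * ((β - α) * N ^ 2) := by
  have hN0 : 0 ≤ N := by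
    have h := (abs_nonneg _).trans (hres α)
    nlinarith
  -- the ansatz and the error field
  obtain ⟨haC2, hat1, ha0, ha1, hares⟩ := odd_ansatz_facts hg hω.ne' V
  set ψa : ℝ → ℝ → ℝ := fun t x => g x * (Real.sin (ω * t) / ω) with hψa
  set φ : ℝ → ℝ → ℝ := fun t x => ψ t x - ψa t x with hφ
  have hφ2 : ContDiff ℝ 2 (uncurry φ) := hψ.sub haC2
  have hg0' : ∀ t x, (x < α - |t| ∨ β + |t| < x) → g x = 0 := by
    intro t x hx
    apply hg0
    rcases hx with hx | hx
    · left; linarith [abs_nonneg t]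
    · right; linarith [abs_nonneg t]
  have hφsupp : ∀ t x, (x < α - |t| ∨ β + |t| < x) → φ t x = 0 := by
    intro t x hx
    simp [hφ, hψa, hsupp t x hx, hg0' t x hx]
  have hφ0 : ∀ x, φ 0 x = 0 := fun x => by simp [hφ, hψa, hψ0 x]
  have hψline : ∀ x, HasDerivAt (fun τ => ψ τ x) (g x) 0 := by
    intro x
    have h := (hasDerivAt_time (hψ.of_le (by norm_num)) 0 x).differentiableAt.hasDerivAt
    rwa [hψ1 x] at h
  have hφ1 : ∀ x, deriv (fun τ => φ τ x) 0 = 0 := by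
    intro x
    have h := (hψline x).sub (hat1 0 x)
    have h' : HasDerivAt (fun τ => φ τ x) (g x - g x * Real.cos (ω * 0)) 0 :=
      h.congr_of_eventuallyEq (Eventually.of_forall fun τ => rfl)
    rw [h'.deriv]; simp
  -- the residual of the error field
  have hφres : ∀ t x, iteratedDeriv 2 (fun τ => φ τ x) t - iteratedDeriv 2 (φ t) x + V x * φ t x
      = -(((V x - ω ^ 2) * g x - iteratedDeriv 2 g x) * (Real.sin (ω * t) / ω)) := by
    intro t x
    obtain ⟨hψt, hψx⟩ := contDiff_two_lines hψ t x
    obtain ⟨hat, hax⟩ := contDiff_two_lines haC2 t x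
    have e1 : iteratedDeriv 2 (fun τ => φ τ x) t
        = iteratedDeriv 2 (fun τ => ψ τ x) t - iteratedDeriv 2 (fun τ => ψa τ x) t :=
      iteratedDeriv_two_sub hψt hat t
    have e2 : iteratedDeriv 2 (φ t) x = iteratedDeriv 2 (ψ t) x - iteratedDeriv 2 (ψa t) x :=
      iteratedDeriv_two_sub hψx hax x
    rw [e1, e2]
    have h1 := hsol t x
    have h2 := hares t x
    simp only [hψa] at h2 ⊢
    simp only [hφ, hψa]
    linear_combination h1 - h2
  -- the forcing is supported in `[α, β]` and bounded by `N`
  have hsinb : ∀ t, |Real.sin (ω * t) / ω| ≤ 1 / ω := by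
    intro t
    rw [abs_div, abs_of_pos hω]
    exact div_le_div_of_nonneg_right (Real.abs_sin_le_one _) hω.le
  have hptN : ∀ t x, |((V x - ω ^ 2) * g x - iteratedDeriv 2 g x) * (Real.sin (ω * t) / ω)| ≤ N := by
    intro t x
    rw [abs_mul]
    calc |(V x - ω ^ 2) * g x - iteratedDeriv 2 g x| * |Real.sin (ω * t) / ω|
        ≤ (ω * N) * (1 / ω) :=
          mul_le_mul (hres x) (hsinb t) (abs_nonneg _) (by positivity)
      _ = N := by field_simp
  have hG0 : ∀ t x, (x < α ∨ β < x) →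
      ((V x - ω ^ 2) * g x - iteratedDeriv 2 g x) * (Real.sin (ω * t) / ω) = 0 := by
    intro t x hx
    have hgev : g =ᶠ[𝓝 x] fun _ => (0 : ℝ) := by
      rcases hx with hx | hx
      · filter_upwards [Iio_mem_nhds hx] with y hy using hg0 y (Or.inl hy)
      · filter_upwards [Ioi_mem_nhds hx] with y hy using hg0 y (Or.inr hy)
    rw [hg0 x hx, iteratedDeriv_two_eq_zero_of_eventuallyEq hgev]; ring
  have hN2 : ∀ t ∈ Icc 0 T, ∫ x, (iteratedDeriv 2 (fun τ => φ τ x) t - iteratedDeriv 2 (φ t) x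
      + V x * φ t x) ^ 2 ≤ (β - α) * N ^ 2 := by
    intro t _
    have heq : (fun x => (iteratedDeriv 2 (fun τ => φ τ x) t - iteratedDeriv 2 (φ t) x
        + V x * φ t x) ^ 2)
        = fun x => (((V x - ω ^ 2) * g x - iteratedDeriv 2 g x) * (Real.sin (ω * t) / ω)) ^ 2 := by
      funext x; rw [hφres t x]; ring
    rw [heq]
    have hzero : ∀ x, x ∉ Icc α β →
        (((V x - ω ^ 2) * g x - iteratedDeriv 2 g x) * (Real.sin (ω * t) / ω)) ^ 2 = 0 := by
      intro x hx
      have hx' : x < α ∨ β < x := by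
        by_contra h
        exact hx ⟨le_of_not_gt fun h' => h (Or.inl h'), le_of_not_gt fun h' => h (Or.inr h')⟩
      rw [hG0 t x hx']; ring
    rw [← setIntegral_eq_integral_of_forall_compl_eq_zero hzero]
    have hb : ∀ x ∈ Icc α β,
        ‖(((V x - ω ^ 2) * g x - iteratedDeriv 2 g x) * (Real.sin (ω * t) / ω)) ^ 2‖ ≤ N ^ 2 := by
      intro x _
      rw [Real.norm_eq_abs, abs_pow]
      exact pow_le_pow_left₀ (abs_nonneg _) (hptN t x) 2
    have h := norm_setIntegral_le_of_norm_le_const (μ := volume) (s := Icc α β)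
      (by rw [Real.volume_Icc]; exact ENNReal.ofReal_lt_top) hb
    rw [Real.norm_eq_abs, Measure.real, Real.volume_Icc, ENNReal.toReal_ofReal (by linarith)] at h
    calc ∫ x in Icc α β, (((V x - ω ^ 2) * g x - iteratedDeriv 2 g x) * (Real.sin (ω * t) / ω)) ^ 2
        ≤ |∫ x in Icc α β,
            (((V x - ω ^ 2) * g x - iteratedDeriv 2 g x) * (Real.sin (ω * t) / ω)) ^ 2| :=
          le_abs_self _
      _ ≤ N ^ 2 * (β - α) := h
      _ = (β - α) * N ^ 2 := by ring
  -- the energy inequality for the error field on `[0, T]`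
  have hEφ := energy_le_of_forcing hφ2 hV1 hVnn hφsupp hφ0 hφ1 hT
    (mul_nonneg (by linarith) (sq_nonneg N)) hN2
  -- to the left of `α` the densities of `ψ` and `φ` agree (`ψₐ ≡ 0` there)
  have hagree : ∀ t, ∀ x ∈ Iio α,
      deriv (fun τ => ψ τ x) t ^ 2 + deriv (ψ t) x ^ 2 + V x * ψ t x ^ 2
        = deriv (fun τ => φ τ x) t ^ 2 + deriv (φ t) x ^ 2 + V x * φ t x ^ 2 := by
    intro t x hx
    have hgx : g x = 0 := hg0 x (Or.inl hx)
    have h1 : (fun τ => φ τ x) = fun τ => ψ τ x := by funext τ; simp [hφ, hψa, hgx]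
    have h2 : φ t =ᶠ[𝓝 x] ψ t := by
      filter_upwards [Iio_mem_nhds hx] with y hy
      simp [hφ, hψa, hg0 y (Or.inl hy)]
    have h3 : φ t x = ψ t x := by simp [hφ, hψa, hgx]
    rw [h1, h2.deriv_eq, h3]
  intro t ht
  have he0 : ∀ x, 0 ≤ deriv (fun τ => φ τ x) t ^ 2 + deriv (φ t) x ^ 2 + V x * φ t x ^ 2 :=
    fun x => by have := mul_nonneg (hVnn x) (sq_nonneg (φ t x)); positivity
  calc ∫ x in Iio α, (deriv (fun τ => ψ τ x) t ^ 2 + deriv (ψ t) x ^ 2 + V x * ψ t x ^ 2)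
      = ∫ x in Iio α, (deriv (fun τ => φ τ x) t ^ 2 + deriv (φ t) x ^ 2 + V x * φ t x ^ 2) :=
        setIntegral_congr_fun measurableSet_Iio (hagree t)
    _ ≤ ∫ x, (deriv (fun τ => φ τ x) t ^ 2 + deriv (φ t) x ^ 2 + V x * φ t x ^ 2) :=
        setIntegral_le_integral (integrable_energyDensity hV1.continuous hφ2 hφsupp t)
          (Eventually.of_forall he0)
    _ ≤ (Real.exp 1 - 1) * T ^ 2 * ((β - α) * N ^ 2) := hEφ t ht

/-! ### Time reversal -/

/-- **Time reversal.** If `ψ ∈ C²` solves `ψ_tt − ψ_xx + Vψ = 0` with data `(0, g)` and vanishes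
outside the domain of influence of `[α, β]`, then so does `(t, x) ↦ ψ(−t, x)`, with data
`(0, −g)`; its energy density at time `t` is that of `ψ` at time `−t`. -/
theorem time_reverse {V : ℝ → ℝ} {ψ : ℝ → ℝ → ℝ} {α β : ℝ} (hψ : ContDiff ℝ 2 (uncurry ψ))
    (hsol : ∀ t x, iteratedDeriv 2 (fun τ => ψ τ x) t - iteratedDeriv 2 (ψ t) x + V x * ψ t x = 0)
    (hsupp : ∀ t x, (x < α - |t| ∨ β + |t| < x) → ψ t x = 0)
    (hψ0 : ∀ x, ψ 0 x = 0) {g : ℝ → ℝ} (hψ1 : ∀ x, deriv (fun τ => ψ τ x) 0 = g x) :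
    ContDiff ℝ 2 (uncurry fun t x => ψ (-t) x) ∧
    (∀ t x, iteratedDeriv 2 (fun τ => (fun s y => ψ (-s) y) τ x) t
      - iteratedDeriv 2 ((fun s y => ψ (-s) y) t) x + V x * (fun s y => ψ (-s) y) t x = 0) ∧
    (∀ t x, (x < α - |t| ∨ β + |t| < x) → (fun s y => ψ (-s) y) t x = 0) ∧
    (∀ x, (fun s y => ψ (-s) y) 0 x = 0) ∧
    (∀ x, deriv (fun τ => (fun s y => ψ (-s) y) τ x) 0 = -g x) ∧
    (∀ t x, deriv (fun τ => (fun s y => ψ (-s) y) τ x) t ^ 2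
        + deriv ((fun s y => ψ (-s) y) t) x ^ 2 + V x * (fun s y => ψ (-s) y) t x ^ 2
      = deriv (fun τ => ψ τ x) (-t) ^ 2 + deriv (ψ (-t)) x ^ 2 + V x * ψ (-t) x ^ 2) := by
  refine ⟨?_, fun t x => ?_, fun t x hx => ?_, fun x => by simp [hψ0 x], fun x => ?_, fun t x => ?_⟩
  · exact hψ.comp ((contDiff_neg.comp contDiff_fst).prodMk contDiff_snd)
  · have h1 : iteratedDeriv 2 (fun τ => ψ (-τ) x) t = iteratedDeriv 2 (fun τ => ψ τ x) (-t) := by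
      rw [iteratedDeriv_comp_neg 2 (fun τ => ψ τ x) t]
      norm_num
    show iteratedDeriv 2 (fun τ => ψ (-τ) x) t - iteratedDeriv 2 (ψ (-t)) x + V x * ψ (-t) x = 0
    rw [h1]
    exact hsol (-t) x
  · show ψ (-t) x = 0
    apply hsupp
    rwa [abs_neg]
  · show deriv (fun τ => ψ (-τ) x) 0 = -g x
    rw [deriv_comp_neg (fun τ => ψ τ x) 0, neg_zero, hψ1 x]
  · show deriv (fun τ => ψ (-τ) x) t ^ 2 + deriv (ψ (-t)) x ^ 2 + V x * ψ (-t) x ^ 2 = _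
    rw [deriv_comp_neg (fun τ => ψ τ x) t]
    ring

end Energy

end Summit.FinalStateConjecture.FinalStateConjecture.Theorems.FrozenPacket

end
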